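import Literature.NumberTheory.LFunctions.RodgersTaoZeroDynamicsProofs
import Mathlib.Topology.UniformSpace.Dini
import Mathlib.MeasureTheory.Integral.IntervalIntegral.FundThmCalculus
import HarnessLib

/-!
# Rodgers–Tao Lemma 14 (gap / cross-energy inequality): continuity of the cross energy and the
# RH-free CONTENT form

RH-FREE CONTENT (cell rh-crit, corpus C3, seat t4; trunk T-ANT). Proofs only — NO definition, NO
named fact. Vocabulary of `RodgersTaoZeroDynamics.lean` (`deBruijnZeroZ`, `interactionEnergy`,
`zstarIcc`, `zstarCompl`, `rodgersTaoCrossSum`). Sibling of the statements file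
`RodgersTaoGapsEnergy.lean`, whose named fact
`Literature.NumberTheory.LFunctions.rodgers_tao_gap_cross_energy` types Rodgers–Tao 2020,
**Lemma 14** (= arXiv:1801.05914v4 Lemma 5.2; Forum Math. Pi 8 (2020) e6, p. 34) AS PRINTED, i.e.
on the range `Λ/2 ≤ t ≤ 0` — a range that is EMPTY now that `Λ ≥ 0` is a theorem
(`rodgers_tao_holds`), so that fact is discharged there only EX FALSO. The mathematics of the
printed proof (pp. 34–35) is nevertheless RH-free: it is an argument about the zero flow of `H_t`
on ANY time interval above `Λ`. This file proves that content in HOUSE (time-translated) FORM, with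
the printed "`≫` (constants depending on `Λ`)" made explicit as a dependence on the elapsed time
`t − t₀`.

## Part I — uniform growth of the zeros and continuity of the cross energy

The printed proof needs "the sum defining `B(t)` is uniformly convergent … and hence `B(t)` is at
least continuous" (p. 34) for the cross energy `B(t) = Σ_{k ∈ K} Σ_{j ∉ K} E_{jk}(t)`:

* `hasSum_inv_deBruijnZero_sq_add_one` — `Σ_{j ≥ 1} 1/(x_j(t)² + 1) = Re((i/2)·H_t'(i)/H_t(i))`
  (the grouped partial-fraction series of `H_t'/H_t`, `IsHadamardSeq.logDeriv_eq`, at `z = i`);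
  `continuousAt_logDeriv_I` — the right-hand side is continuous in `t`;
* `le_mul_deBruijnZero_sq_add_one` — uniform growth `n ≤ A (x_n(t)² + 1)`; `exists_bound_logDeriv_I`,
  `exists_bound_deBruijnZeroZ` — uniform bounds on compact time intervals;
  `interactionEnergy_le_of_sq_ge` — `E_{jk}(t) ≤ 8/(x_{|j|}(t)² + 1)` beyond the growth threshold;
* `tendstoUniformlyOn_sum_inv_sq_add_one` — by DINI's theorem the series converges uniformly on
  compact time intervals above `Λ`; `exists_uniform_tail_lt` — uniform tails;
* `tsum_zstarCompl_eq_sum_add_tsum`, `tsum_far_le_two_mul_tsum_nat`, `exists_far_crossEnergy_le` —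
  window/far splitting; the far cross energy is at most `16 ×` a tail of the series above;
* `continuousOn_crossEnergy` — **`t ↦ Σ_{k ∈ K} Σ_{j ∈ ℤ* ∖ K} E_{jk}(t)` is continuous on every
  `[t₁, t₂]` with `Λ < t₁`** (uniform limit of the continuous window sums).

## Part II — the CONTENT form of Lemma 14

* `rodgers_tao_gap_cross_energy_of_lt` — for `t₀ < t` with `H_{t₀}` real-rooted (i.e. `Λ ≤ t₀ < t`)
  and every finite `K ⊂ ℤ*` with `|K| ≥ 2`,
  `Σ_{k ≠ k' ∈ K} (x_k(t) − x_{k'}(t))² ≥ c |K|³ / (1 + Σ_{k ∈ K, j ∉ K} E_{jk}(t))` with the explicit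
  `c = min((t − t₀)/2, 1/64)`, uniform in `K`.

It is the first consumer of the kernel forms of Lemma 12 (ii) (cross-energy inequality,
`rodgers_tao_cross_energy_inequality_holds`) and (iv) (virial identity,
`rodgers_tao_virial_identity_holds`) of `RodgersTaoZeroDynamicsProofs.lean`. Route = the printed
proof: `abs_rodgersTaoCrossSum_le_crossEnergy` (the environment sum is `O(B)`, AM–GM);
`quartic_sum_le_sq_crossEnergy` + `crossEnergy_le_add_integral_sq` ("`∂_t B ≥ −8B²` in the weak
sense", cf. Csordas–Smith–Varga 1994 Lemma 2.5); `crossEnergy_le_on_left` ("`B(t')` cannot attain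
or exceed the value `2B(t)`" on a left neighbourhood of `t` of length `≫ 1/(1+B(t))` — here
`min((t−t₀)/2, 1/(64(B(t)+1)))`, by continuity of `B`, a supremum argument and the intermediate
value theorem); and the Gronwall step for `A = Σ (x_k − x_{k'})²`, `∂_t A ≥ 4|K|²(|K|−1) − 2B·A`,
run as monotonicity of `(A − N₀/β) e^{βt}`. The intermediate statements take Lemma 12 (ii)/(iv) as
hypotheses `(hii : rodgers_tao_cross_energy_inequality) (hiv : rodgers_tao_virial_identity)`; the
final theorem feeds them the kernel discharges.

## References

* B. Rodgers, T. Tao, *The de Bruijn–Newman constant is non-negative*, Forum Math. Pi 8 (2020),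
  e6 = arXiv:1801.05914v4: §4 p. 29 («locally uniformly in t»), Lemma 14 (= v4 Lemma 5.2) and its
  proof, pp. 34–35.
* G. Csordas, W. Smith, R. S. Varga, *Lehmer pairs of zeros, the de Bruijn–Newman constant Λ, and
  the Riemann Hypothesis*, Constr. Approx. 10 (1994), Lemma 2.5.
* D. H. J. Polymath, *Effective approximation of heat flow evolution of the Riemann ξ function…*,
  Res. Math. Sci. 6 (2019), §3 (partial fractions of `H_t'/H_t`).

LABEL: RH-FREE CONTENT; the printed `Λ/2 ≤ t ≤ 0` statement stays VACUOUS-AS-PRINTED / EX-FALSO in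
`RodgersTaoGapsEnergy.lean`; bears_on N-C/N-P (COLUMN 3 DBN). WHAT THIS IS NOT: not the printed
statement, not a bound at `t = 0`, not progress toward RH; nothing here bears on the truth of RH.
-/
noncomputable section

open Filter Set Topology MeasureTheory

namespace Literature.NumberTheory.LFunctions

/-- Splitting a sum over `ℤ* ∖ K` along the window `[−R, R]` when `K ⊆ [−R, R]_{ℤ*}`:
`Σ_{j ∈ ℤ* ∖ K} f(j) = Σ_{j ∈ [−R,R]_{ℤ*} ∖ K} f(j) + Σ_{|j| > R} f(j)` for a summable `f`.
[cite: RodgersTaoFMP2020, Lemma 12 (ii) p. 31] -/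
theorem tsum_zstarCompl_eq_sum_add_tsum {f : ℤ → ℝ} (hf : Summable f) {K : Finset ℤ} {R : ℕ}
    (hKR : K ⊆ zstarIcc (-(R : ℤ)) R) :
    ∑' j : zstarCompl K, f j = ∑ j ∈ zstarIcc (-(R : ℤ)) R \ K, f j +
      ∑' j : ↥((↑(Finset.Icc (-(R : ℤ)) R) : Set ℤ)ᶜ), f j := by
  classical
  set C : Set ℤ := zstarCompl K with hC
  have hg : Summable (C.indicator f) := hf.indicator C
  rw [tsum_subtype C f, ← hg.sum_add_tsum_compl (s := Finset.Icc (-(R : ℤ)) R)]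
  congr 1
  · rw [← Finset.sum_filter_add_sum_filter_not (Finset.Icc (-(R : ℤ)) R) (· ∈ C)]
    have hzero : ∑ j ∈ (Finset.Icc (-(R : ℤ)) R).filter (· ∉ C), C.indicator f j = 0 :=
      Finset.sum_eq_zero fun j hj ↦ Set.indicator_of_notMem (Finset.mem_filter.1 hj).2 _
    rw [hzero, add_zero]
    have hset : (Finset.Icc (-(R : ℤ)) R).filter (· ∈ C) = zstarIcc (-(R : ℤ)) R \ K := by
      ext j
      simp only [Finset.mem_filter, Finset.mem_Icc, hC, mem_zstarCompl, Finset.mem_sdiff,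
        mem_zstarIcc]
      tauto
    rw [hset]
    refine Finset.sum_congr rfl fun j hj ↦ Set.indicator_of_mem (show j ∈ C from ?_) _
    rw [← hset, Finset.mem_filter] at hj
    exact hj.2
  · refine tsum_congr fun j ↦ Set.indicator_of_mem (show (j : ℤ) ∈ C from ?_) _
    have hj := j.2
    rw [Set.mem_compl_iff, Finset.mem_coe, Finset.mem_Icc] at hj
    rw [hC, mem_zstarCompl]
    refine ⟨by omega, fun hjK ↦ hj ?_⟩
    have := mem_zstarIcc.1 (hKR hjK)
    omega

/-- `K ⊆ [−R, R]_{ℤ*}` for every `R ≥ max_{k ∈ K} |k|` when `0 ∉ K`.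
[cite: RodgersTaoFMP2020, §1.2 p. 7] -/
theorem subset_zstarIcc_of_le {K : Finset ℤ} (hK0 : (0 : ℤ) ∉ K) {R : ℕ}
    (hR : K.sup Int.natAbs ≤ R) : K ⊆ zstarIcc (-(R : ℤ)) R := by
  intro k hk
  have h1 : k.natAbs ≤ R := (Finset.le_sup hk).trans hR
  rw [mem_zstarIcc]
  exact ⟨fun h ↦ hK0 (h ▸ hk), by omega, by omega⟩

/-- `|x_j(t)| = x_{|j|}(t)` (oddness of the enumeration, `x ≥ 0` on natural indices).
[cite: RodgersTaoFMP2020, §1.2 p. 7] -/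
theorem abs_deBruijnZeroZ (t : ℝ) (j : ℤ) : |deBruijnZeroZ t j| = deBruijnZero t j.natAbs := by
  obtain ⟨n, rfl | rfl⟩ := Int.eq_nat_or_neg j
  · rw [deBruijnZeroZ_natCast, Int.natAbs_natCast, abs_of_nonneg (deBruijnZero_nonneg t n)]
  · rw [deBruijnZeroZ_neg_natCast, abs_neg, Int.natAbs_neg, Int.natAbs_natCast,
      abs_of_nonneg (deBruijnZero_nonneg t n)]

/-- **`Σ_{j ≥ 1} 1/(x_j(t)² + 1) = Re((i/2)·H_t'(i)/H_t(i))`** for `t > Λ`: the grouped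
partial-fraction series `H_t'/H_t (z) = Σ_j 2 c_j z/(1 + c_j z²)`, `c_j = −1/x_j²`
(`IsHadamardSeq.logDeriv_eq` with `isHadamardSeq_deBruijnZero`), evaluated at `z = i`, where
`H_t(i) ≠ 0` because the zeros of `H_t` are real.
[cite: Polymath2019, §3] -/
theorem hasSum_inv_deBruijnZero_sq_add_one {t : ℝ}
    (hΛ : ∃ t₁ : ℝ, t₁ < t ∧ HasOnlyRealZeros (deBruijnH t₁)) :
    HasSum (fun n : ℕ ↦ 1 / (deBruijnZero t (n + 1) ^ 2 + 1))
      ((Complex.I / 2 * logDeriv (deBruijnH t) Complex.I).re) := by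
  have h := isHadamardSeq_deBruijnZero hΛ
  have hreal : HasOnlyRealZeros (deBruijnH t) := hasOnlyRealZeros_of_exists_lt hΛ
  have hz : deBruijnH t Complex.I ≠ 0 := by
    intro h0
    have := hreal _ h0
    simp at this
  have hsum := (summable_logDeriv_terms h.summable Complex.I).hasSum
  rw [← h.logDeriv_eq hz] at hsum
  have h2 := Complex.reCLM.hasSum (hsum.mul_left (Complex.I / 2))
  simp only [Complex.reCLM_apply] at h2
  convert h2 using 2 with n
  have hx : (0 : ℝ) < deBruijnZero t (n + 1) := deBruijnZero_pos hΛ (by omega)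
  set X : ℂ := ((deBruijnZero t (n + 1) : ℝ) : ℂ) with hX
  have hX0 : X ≠ 0 := by rw [hX]; exact_mod_cast hx.ne'
  have hX1 : X ^ 2 + 1 ≠ 0 := by
    rw [hX]; norm_cast; positivity
  have key : Complex.I / 2 * (2 * (-1 / X ^ 2) * Complex.I / (1 + -1 / X ^ 2 * Complex.I ^ 2)) =
      1 / (X ^ 2 + 1) := by
    rw [Complex.I_sq]
    field_simp
    rw [Complex.I_sq]
    ring
  rw [key, hX]
  norm_cast

/-- The function `t ↦ Re((i/2)·H_t'(i)/H_t(i))` is continuous at every `t > Λ` (joint continuity of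
`H` and `H'` in `(t, z)`; `H_t(i) ≠ 0`).
[cite: Polymath2019, §3] -/
theorem continuousAt_logDeriv_I {t : ℝ}
    (hΛ : ∃ t₁ : ℝ, t₁ < t ∧ HasOnlyRealZeros (deBruijnH t₁)) :
    ContinuousAt (fun s : ℝ ↦ (Complex.I / 2 * logDeriv (deBruijnH s) Complex.I).re) t := by
  have hreal : HasOnlyRealZeros (deBruijnH t) := hasOnlyRealZeros_of_exists_lt hΛ
  have hz : deBruijnH t Complex.I ≠ 0 := by
    intro h0
    have := hreal _ h0
    simp at this
  have h1 : ContinuousAt (fun s : ℝ ↦ deBruijnH s Complex.I) t :=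
    (continuous_deBruijnH_uncurry.comp (continuous_id.prodMk continuous_const)).continuousAt
  have h2 : ContinuousAt (fun s : ℝ ↦ deriv (deBruijnH s) Complex.I) t :=
    (continuous_deriv_deBruijnH_uncurry.comp (continuous_id.prodMk continuous_const)).continuousAt
  simp only [logDeriv_apply]
  exact Complex.continuous_re.continuousAt.comp (continuousAt_const.mul (h2.div h1 hz))

/-- **Uniform lower growth of the zeros**: if `Re((i/2)·H_t'(i)/H_t(i)) ≤ A` then
`n ≤ A (x_n(t)² + 1)` for every `n ≥ 1` (`t > Λ`): the terms `1/(x_m² + 1)`, `m ≤ n`, of the series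
`hasSum_inv_deBruijnZero_sq_add_one` decrease in `m` and sum to at most `A`.
[cite: Polymath2019, §3] -/
theorem le_mul_deBruijnZero_sq_add_one {t : ℝ}
    (hΛ : ∃ t₁ : ℝ, t₁ < t ∧ HasOnlyRealZeros (deBruijnH t₁)) {A : ℝ}
    (hA : (Complex.I / 2 * logDeriv (deBruijnH t) Complex.I).re ≤ A) (n : ℕ) :
    (n : ℝ) ≤ A * (deBruijnZero t n ^ 2 + 1) := by
  have hS := hasSum_inv_deBruijnZero_sq_add_one hΛ
  have hmono := strictMono_deBruijnZero hΛ
  -- partial sum over `m < n` is at least `n · 1/(x_n² + 1)` and at most `A`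
  have h1 : ∑ m ∈ Finset.range n, 1 / (deBruijnZero t (m + 1) ^ 2 + 1) ≤ A :=
    (sum_le_hasSum _ (fun m _ ↦ by positivity) hS).trans hA
  have h2 : ∀ m ∈ Finset.range n,
      1 / (deBruijnZero t n ^ 2 + 1) ≤ 1 / (deBruijnZero t (m + 1) ^ 2 + 1) := by
    intro m hm
    have hmn : m + 1 ≤ n := Finset.mem_range.1 hm
    have hle : deBruijnZero t (m + 1) ≤ deBruijnZero t n := hmono.monotone hmn
    have h0 : 0 ≤ deBruijnZero t (m + 1) := deBruijnZero_nonneg t _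
    exact one_div_le_one_div_of_le (by positivity) (by nlinarith)
  have h3 : (n : ℝ) * (1 / (deBruijnZero t n ^ 2 + 1)) ≤
      ∑ m ∈ Finset.range n, 1 / (deBruijnZero t (m + 1) ^ 2 + 1) := by
    have := Finset.card_nsmul_le_sum (Finset.range n) _ _ h2
    simpa using this
  have h4 : (n : ℝ) * (1 / (deBruijnZero t n ^ 2 + 1)) ≤ A := h3.trans h1
  have hpos : 0 < deBruijnZero t n ^ 2 + 1 := by positivity
  rw [mul_one_div, div_le_iff₀ hpos] at h4
  exact h4

/-- A uniform bound for finitely many zeros on a compact time interval above `Λ`: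
`|x_k(t)| ≤ M` for all `t ∈ [t₁, t₂]`, `k ∈ K`.
[cite: RodgersTaoFMP2020, Thm. 11 p. 27] -/
theorem exists_bound_deBruijnZeroZ {t₀ t₁ t₂ : ℝ} (hreal : HasOnlyRealZeros (deBruijnH t₀))
    (ht₀ : t₀ < t₁) (K : Finset ℤ) :
    ∃ M : ℝ, 0 ≤ M ∧ ∀ t ∈ Icc t₁ t₂, ∀ k ∈ K, |deBruijnZeroZ t k| ≤ M := by
  have hcont : ContinuousOn (fun t ↦ ∑ k ∈ K, |deBruijnZeroZ t k|) (Icc t₁ t₂) := by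
    refine continuousOn_finsetSum K fun k _ t ht ↦ ?_
    have hΛt : ∃ t₁' : ℝ, t₁' < t ∧ HasOnlyRealZeros (deBruijnH t₁') :=
      ⟨t₀, lt_of_lt_of_le ht₀ ht.1, hreal⟩
    exact (continuous_abs.continuousAt.comp (continuousAt_deBruijnZeroZ hΛt k)).continuousWithinAt
  obtain ⟨C, hC⟩ := isCompact_Icc.exists_bound_of_continuousOn hcont
  refine ⟨max C 0, le_max_right _ _, fun t ht k hk ↦ ?_⟩
  have h1 : |deBruijnZeroZ t k| ≤ ∑ k ∈ K, |deBruijnZeroZ t k| :=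
    Finset.single_le_sum (f := fun k ↦ |deBruijnZeroZ t k|) (fun _ _ ↦ abs_nonneg _) hk
  have h2 := hC t ht
  rw [Real.norm_eq_abs, abs_of_nonneg (Finset.sum_nonneg fun _ _ ↦ abs_nonneg _)] at h2
  exact (h1.trans h2).trans (le_max_left _ _)

/-- A uniform bound `A ≥ 1` for `Re((i/2) H_t'(i)/H_t(i)) = Σ_j 1/(x_j(t)² + 1)` on a compact time
interval above `Λ`.
[cite: Polymath2019, §3] -/
theorem exists_bound_logDeriv_I {t₀ t₁ t₂ : ℝ} (hreal : HasOnlyRealZeros (deBruijnH t₀))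
    (ht₀ : t₀ < t₁) :
    ∃ A : ℝ, 1 ≤ A ∧ ∀ t ∈ Icc t₁ t₂, (Complex.I / 2 * logDeriv (deBruijnH t) Complex.I).re ≤ A := by
  have hcont : ContinuousOn (fun t : ℝ ↦ (Complex.I / 2 * logDeriv (deBruijnH t) Complex.I).re)
      (Icc t₁ t₂) := fun t ht ↦
    (continuousAt_logDeriv_I ⟨t₀, lt_of_lt_of_le ht₀ ht.1, hreal⟩).continuousWithinAt
  obtain ⟨C, hC⟩ := isCompact_Icc.exists_bound_of_continuousOn hcont
  refine ⟨max C 1, le_max_right _ _, fun t ht ↦ ?_⟩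
  have h := hC t ht
  rw [Real.norm_eq_abs] at h
  exact ((le_abs_self _).trans h).trans (le_max_left _ _)

/-- `Σ_{j ∈ ℤ} E_{jk}(t)` converges (`t > Λ`); local copy of
`summable_interactionEnergy_int` of `RodgersTaoZeroDynamicsProofs.lean` (rev 4).
[cite: RodgersTaoFMP2020, Lemma 12 (ii) p. 30] -/
private theorem summable_interactionEnergy_int_aux {t : ℝ}
    (hΛ : ∃ t₁ : ℝ, t₁ < t ∧ HasOnlyRealZeros (deBruijnH t₁)) (k : ℤ) :
    Summable fun j : ℤ ↦ interactionEnergy t j k :=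
  (summable_rodgersTaoCrossTerm_int hΛ k k).congr fun j ↦ by
    rw [rodgersTaoCrossTerm_eq, interactionEnergy_eq, sq]

/-- **Growth threshold**: if `Re((i/2) H_t'(i)/H_t(i)) ≤ A` (`A ≥ 1`), `M ≥ 0` and
`n ≥ N ≥ 2A(4M² + 2)`, then `x_n(t)² ≥ 4M² + 1` (so `|x_n(t)| ≥ 2M` and `|x_n(t)| ≥ 1`).
[cite: RodgersTaoFMP2020, Thm. 11 p. 27] -/
theorem sq_deBruijnZero_ge_of_growth {t : ℝ}
    (hΛ : ∃ t₁ : ℝ, t₁ < t ∧ HasOnlyRealZeros (deBruijnH t₁)) {A M : ℝ} (hA1 : 1 ≤ A)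
    (hA : (Complex.I / 2 * logDeriv (deBruijnH t) Complex.I).re ≤ A) {N n : ℕ}
    (hN : 2 * A * (4 * M ^ 2 + 2) ≤ N) (hn : N ≤ n) :
    4 * M ^ 2 + 1 ≤ deBruijnZero t n ^ 2 := by
  have hA0 : 0 < A := by linarith
  have hgrow : (n : ℝ) ≤ A * (deBruijnZero t n ^ 2 + 1) := le_mul_deBruijnZero_sq_add_one hΛ hA n
  have hnN : (N : ℝ) ≤ n := by exact_mod_cast hn
  have h1 : 2 * (4 * M ^ 2 + 2) ≤ (n : ℝ) / A := by
    rw [le_div_iff₀ hA0]; linarith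
  have h2 : (n : ℝ) / A ≤ deBruijnZero t n ^ 2 + 1 := by rw [div_le_iff₀ hA0]; linarith
  linarith [sq_nonneg M]

/-- Beyond the growth threshold the interaction energy with a bounded zero is dominated by the
series term: if `|x_k(t)| ≤ M` and `x_{|j|}(t)² ≥ 4M² + 1`, then
`E_{jk}(t) = 1/(x_j − x_k)² ≤ 4/x_j² ≤ 8/(x_{|j|}(t)² + 1)`. [cite: RodgersTaoFMP2020, Lemma 14 p. 34] -/
theorem interactionEnergy_le_of_sq_ge {t M : ℝ} (hM : 0 ≤ M) {j k : ℤ}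
    (hk : |deBruijnZeroZ t k| ≤ M) (hj : 4 * M ^ 2 + 1 ≤ deBruijnZero t j.natAbs ^ 2) :
    interactionEnergy t j k ≤ 8 / (deBruijnZero t j.natAbs ^ 2 + 1) := by
  set d := deBruijnZero t j.natAbs with hd
  have hd0 : 0 ≤ d := deBruijnZero_nonneg t _
  have habs : |deBruijnZeroZ t j| = d := abs_deBruijnZeroZ t j
  have h2M : 2 * M ≤ d := by nlinarith
  have hd1 : 1 ≤ d ^ 2 := by nlinarith
  rw [interactionEnergy_eq]
  set g := deBruijnZeroZ t j - deBruijnZeroZ t k with hg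
  have hdiff : d / 2 ≤ |g| := by
    have h1 : |deBruijnZeroZ t j| - |deBruijnZeroZ t k| ≤ |g| := abs_sub_abs_le_abs_sub _ _
    rw [habs] at h1
    linarith
  have hdpos : 0 < d := by nlinarith
  have hg2 : (d / 2) ^ 2 ≤ g ^ 2 := by
    have := pow_le_pow_left₀ (by positivity) hdiff 2
    rwa [sq_abs] at this
  have hg0 : 0 < g ^ 2 := lt_of_lt_of_le (by positivity) hg2
  rw [div_le_div_iff₀ hg0 (by positivity)]
  nlinarith

/-- **Dini**: the series `Σ_{m ≥ 0} 1/(x_{m+1}(t)² + 1)` of `hasSum_inv_deBruijnZero_sq_add_one`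
converges UNIFORMLY on every compact time interval `[t₁, t₂]` with `Λ < t₁` (its terms and its sum
`Re((i/2) H_t'(i)/H_t(i))` are continuous in `t`, the partial sums increase). This is the uniformity
behind the source's "locally uniformly in `t`" (p. 29) / "uniformly convergent" (p. 34).
[cite: RodgersTaoFMP2020, Lemma 14 p. 34] -/
theorem tendstoUniformlyOn_sum_inv_sq_add_one {t₀ t₁ t₂ : ℝ}
    (hreal : HasOnlyRealZeros (deBruijnH t₀)) (ht₀ : t₀ < t₁) :
    TendstoUniformlyOn
      (fun (n : ℕ) (t : ℝ) ↦ ∑ m ∈ Finset.range n, 1 / (deBruijnZero t (m + 1) ^ 2 + 1))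
      (fun t ↦ (Complex.I / 2 * logDeriv (deBruijnH t) Complex.I).re) atTop (Icc t₁ t₂) := by
  have hΛs : ∀ t ∈ Icc t₁ t₂, ∃ t₁' : ℝ, t₁' < t ∧ HasOnlyRealZeros (deBruijnH t₁') :=
    fun t ht ↦ ⟨t₀, lt_of_lt_of_le ht₀ ht.1, hreal⟩
  refine Monotone.tendstoUniformlyOn_of_forall_tendsto isCompact_Icc (fun n ↦ ?_)
    (fun t _ ↦ ?_) (fun t ht ↦ (continuousAt_logDeriv_I (hΛs t ht)).continuousWithinAt)
    (fun t ht ↦ (hasSum_inv_deBruijnZero_sq_add_one (hΛs t ht)).tendsto_sum_nat)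
  · refine continuousOn_finsetSum _ fun m _ t ht ↦ ?_
    have hx : ContinuousAt (fun s ↦ deBruijnZero s (m + 1)) t := by
      have := continuousAt_deBruijnZeroZ (hΛs t ht) ((m + 1 : ℕ) : ℤ)
      refine this.congr (Eventually.of_forall fun s ↦ ?_)
      exact deBruijnZeroZ_natCast s (m + 1)
    exact (continuousAt_const.div ((hx.pow 2).add continuousAt_const)
      (ne_of_gt (add_pos_of_nonneg_of_pos (sq_nonneg _) one_pos))).continuousWithinAt
  · intro a b hab
    exact Finset.sum_le_sum_of_subset_of_nonneg (Finset.range_mono hab)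
      fun m _ _ ↦ by positivity

/-- **Uniform tails**: on `[t₁, t₂]` (`Λ < t₁`), for every `ε > 0` there is `n₀` such that
`Σ_{m ≥ n} 1/(x_{m+1}(t)² + 1) < ε` for all `n ≥ n₀` and all `t ∈ [t₁, t₂]`.
[cite: RodgersTaoFMP2020, Lemma 14 p. 34] -/
theorem exists_uniform_tail_lt {t₀ t₁ t₂ : ℝ} (hreal : HasOnlyRealZeros (deBruijnH t₀))
    (ht₀ : t₀ < t₁) {ε : ℝ} (hε : 0 < ε) :
    ∃ n₀ : ℕ, ∀ n : ℕ, n₀ ≤ n → ∀ t ∈ Icc t₁ t₂,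
      ∑' m : ℕ, 1 / (deBruijnZero t (m + n + 1) ^ 2 + 1) < ε := by
  have hU := Metric.tendstoUniformlyOn_iff.1 (tendstoUniformlyOn_sum_inv_sq_add_one
    (t₂ := t₂) hreal ht₀) ε hε
  obtain ⟨n₀, hn₀⟩ := eventually_atTop.1 hU
  refine ⟨n₀, fun n hn t ht ↦ ?_⟩
  have hΛt : ∃ t₁' : ℝ, t₁' < t ∧ HasOnlyRealZeros (deBruijnH t₁') :=
    ⟨t₀, lt_of_lt_of_le ht₀ ht.1, hreal⟩
  have hS := hasSum_inv_deBruijnZero_sq_add_one hΛt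
  have hsplit := hS.summable.sum_add_tsum_nat_add n
  -- `dist (sum) (partial sum) = tail`
  have h := hn₀ n hn t ht
  rw [Real.dist_eq] at h
  have htail : ∑' m : ℕ, 1 / (deBruijnZero t (m + n + 1) ^ 2 + 1) =
      (Complex.I / 2 * logDeriv (deBruijnH t) Complex.I).re -
        ∑ m ∈ Finset.range n, 1 / (deBruijnZero t (m + 1) ^ 2 + 1) := by
    rw [← hS.tsum_eq, ← hsplit]
    simp only [add_tsub_cancel_left]
  rw [htail]
  exact lt_of_le_of_lt (le_abs_self _) h

/-- Summing an even, far-supported comparison over `ℤ`: if `f j ≤ g |j|` for `|j| > R` (`g ≥ 0`), then `Σ_{|j| > R} f(j) ≤ 2 Σ_{n > R} g(n)`; here in the concrete form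
used below, with the far set `{j : |j| > R}` written as the complement of `Icc (−R) R`.
[cite: RodgersTaoFMP2020, Lemma 14 p. 34] -/
theorem tsum_far_le_two_mul_tsum_nat {f : ℤ → ℝ} {g : ℕ → ℝ} {R : ℕ}
    (hg0 : ∀ n, 0 ≤ g n) (hg : Summable fun m : ℕ ↦ g (m + R + 1))
    (hfg : ∀ j : ℤ, R < j.natAbs → f j ≤ g j.natAbs)
    (hf : Summable f) :
    ∑' j : ↥((↑(Finset.Icc (-(R : ℤ)) R) : Set ℤ)ᶜ), f j ≤ 2 * ∑' m : ℕ, g (m + R + 1) := by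
  classical
  -- the comparison function on `ℤ`
  set F : ℤ → ℝ := fun j ↦ if R < j.natAbs then g j.natAbs else 0 with hF
  have hFnat : HasSum (fun n : ℕ ↦ F n) (∑' m : ℕ, g (m + R + 1)) := by
    refine (hasSum_nat_add_iff' (f := fun n : ℕ ↦ F n) (R + 1)
      (g := ∑' m : ℕ, g (m + R + 1))).1 ?_
    have hzero : ∑ i ∈ Finset.range (R + 1), F i = 0 := by
      refine Finset.sum_eq_zero fun i hi ↦ ?_
      have hi' : ¬ R < i := not_lt.2 (Nat.lt_succ_iff.1 (Finset.mem_range.1 hi))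
      simp only [hF, Int.natAbs_natCast]
      rw [if_neg hi']
    rw [hzero, sub_zero]
    have hfun : (fun n : ℕ ↦ F ((n + (R + 1) : ℕ) : ℤ)) = fun m : ℕ ↦ g (m + R + 1) := by
      funext m
      have hm : R < m + (R + 1) := by omega
      simp only [hF, Int.natAbs_natCast]
      rw [if_pos hm, show m + (R + 1) = m + R + 1 by omega]
    rw [hfun]
    exact hg.hasSum
  have hFneg : HasSum (fun n : ℕ ↦ F (-(n + 1 : ℕ) : ℤ)) (∑' m : ℕ, g (m + R + 1)) := by
    refine (hasSum_nat_add_iff' (f := fun n : ℕ ↦ F (-(n + 1 : ℕ) : ℤ)) R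
      (g := ∑' m : ℕ, g (m + R + 1))).1 ?_
    have hzero : ∑ i ∈ Finset.range R, F (-(i + 1 : ℕ) : ℤ) = 0 := by
      refine Finset.sum_eq_zero fun i hi ↦ ?_
      have hi' : ¬ R < i + 1 := not_lt.2 (Finset.mem_range.1 hi)
      simp only [hF, Int.natAbs_neg, Int.natAbs_natCast]
      rw [if_neg hi']
    rw [hzero, sub_zero]
    have hfun : (fun n : ℕ ↦ F (-((n + R + 1 : ℕ) : ℤ))) = fun m : ℕ ↦ g (m + R + 1) := by
      funext m
      have hm : R < m + R + 1 := by omega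
      simp only [hF, Int.natAbs_neg, Int.natAbs_natCast]
      rw [if_pos hm]
    rw [show (fun n : ℕ ↦ F (-((n + R) + 1 : ℕ) : ℤ)) = fun n : ℕ ↦ F (-((n + R + 1 : ℕ) : ℤ))
      from rfl, hfun]
    exact hg.hasSum
  have hFint : HasSum F (∑' m : ℕ, g (m + R + 1) + ∑' m : ℕ, g (m + R + 1)) :=
    HasSum.of_nat_of_neg_add_one hFnat hFneg
  have hFsum : ∑' j : ℤ, F j = 2 * ∑' m : ℕ, g (m + R + 1) := by rw [hFint.tsum_eq]; ring
  -- compare on the far set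
  have hle : ∑' j : ↥((↑(Finset.Icc (-(R : ℤ)) R) : Set ℤ)ᶜ), f j ≤
      ∑' j : ↥((↑(Finset.Icc (-(R : ℤ)) R) : Set ℤ)ᶜ), F j := by
    refine (hf.subtype _).tsum_le_tsum (fun j ↦ ?_) (hFint.summable.subtype _)
    have hj := j.2
    rw [Set.mem_compl_iff, Finset.mem_coe, Finset.mem_Icc] at hj
    have hR : R < (j : ℤ).natAbs := by omega
    simp only [hF, hR, if_true]
    exact hfg j hR
  have hsub : ∑' j : ↥((↑(Finset.Icc (-(R : ℤ)) R) : Set ℤ)ᶜ), F j ≤ ∑' j : ℤ, F j := by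
    refine Summable.tsum_subtype_le F _ (fun j ↦ ?_) hFint.summable
    simp only [hF]
    split_ifs
    · exact hg0 _
    · exact le_rfl
  linarith

/-- **The far cross energy is uniformly small**: on `[t₁, t₂]` (`Λ < t₁`), for a finite
`K ⊂ ℤ*` and `ε > 0` there is `R₁ ≥ max_{k ∈ K} |k|` such that
`Σ_{|j| > R} E_{jk}(t) ≤ ε` for all `R ≥ R₁`, `t ∈ [t₁, t₂]`, `k ∈ K` ("the sum defining `B(t)` is
uniformly convergent", p. 34). [cite: RodgersTaoFMP2020, Lemma 14 p. 34] -/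
theorem exists_far_crossEnergy_le {t₀ t₁ t₂ : ℝ} (hreal : HasOnlyRealZeros (deBruijnH t₀))
    (ht₀ : t₀ < t₁) (K : Finset ℤ) {ε : ℝ} (hε : 0 < ε) :
    ∃ R₁ : ℕ, K.sup Int.natAbs ≤ R₁ ∧ ∀ R : ℕ, R₁ ≤ R → ∀ t ∈ Icc t₁ t₂, ∀ k ∈ K,
      ∑' j : ↥((↑(Finset.Icc (-(R : ℤ)) R) : Set ℤ)ᶜ), interactionEnergy t j k ≤ ε := by
  have hΛs : ∀ t ∈ Icc t₁ t₂, ∃ t₁' : ℝ, t₁' < t ∧ HasOnlyRealZeros (deBruijnH t₁') :=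
    fun t ht ↦ ⟨t₀, lt_of_lt_of_le ht₀ ht.1, hreal⟩
  obtain ⟨M, hM0, hM⟩ := exists_bound_deBruijnZeroZ (t₁ := t₁) (t₂ := t₂) hreal ht₀ K
  obtain ⟨A, hA1, hA⟩ := exists_bound_logDeriv_I (t₁ := t₁) (t₂ := t₂) hreal ht₀
  obtain ⟨N, hN⟩ := exists_nat_ge (2 * A * (4 * M ^ 2 + 2))
  obtain ⟨n₀, hn₀⟩ := exists_uniform_tail_lt (t₂ := t₂) hreal ht₀ (show 0 < ε / 16 by positivity)
  refine ⟨max (max (K.sup Int.natAbs) N) n₀, (le_max_left _ _).trans (le_max_left _ _),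
    fun R hR t ht k hk ↦ ?_⟩
  have hNR : N ≤ R := ((le_max_right _ _).trans (le_max_left _ _)).trans hR
  have hn₀R : n₀ ≤ R := (le_max_right _ _).trans hR
  have hΛt := hΛs t ht
  have htail := hn₀ R hn₀R t ht
  have hE := summable_interactionEnergy_int_aux hΛt k
  have hg : Summable fun m : ℕ ↦ 8 / (deBruijnZero t (m + R + 1) ^ 2 + 1) :=
    (((hasSum_inv_deBruijnZero_sq_add_one hΛt).summable.comp_injective
      (show Function.Injective (fun m : ℕ ↦ m + R) from add_left_injective R)).mul_left 8).congr
      fun m ↦ by simp only [Function.comp_apply]; ring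
  have h := tsum_far_le_two_mul_tsum_nat (R := R) (f := fun j ↦ interactionEnergy t j k)
    (g := fun n ↦ 8 / (deBruijnZero t n ^ 2 + 1))
    (fun n ↦ by positivity) hg (fun j hj ↦ interactionEnergy_le_of_sq_ge hM0 (hM t ht k hk)
      (sq_deBruijnZero_ge_of_growth hΛt hA1 (hA t ht) hN (hNR.trans hj.le))) hE
  have h8 : ∑' m : ℕ, 8 / (deBruijnZero t (m + R + 1) ^ 2 + 1) =
      8 * ∑' m : ℕ, 1 / (deBruijnZero t (m + R + 1) ^ 2 + 1) := by
    rw [← tsum_mul_left]; exact tsum_congr fun m ↦ by ring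
  rw [h8] at h
  linarith

/-- **Continuity of the cross energy** `B(t) = Σ_{k ∈ K} Σ_{j ∈ ℤ* ∖ K} E_{jk}(t)` on every compact
time interval `[t₁, t₂]` with `Λ < t₁` (source, proof of Lemma 14, p. 34: "the sum defining `B(t)`
is uniformly convergent … and hence `B(t)` is at least continuous"): uniform limit of the
continuous window sums `Σ_{k ∈ K} Σ_{j ∈ [−R,R]_{ℤ*} ∖ K} E_{jk}`. [cite: RodgersTaoFMP2020, Lemma 14 p. 34] -/
theorem continuousOn_crossEnergy {t₀ t₁ t₂ : ℝ} (hreal : HasOnlyRealZeros (deBruijnH t₀))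
    (ht₀ : t₀ < t₁) (K : Finset ℤ) (hK0 : (0 : ℤ) ∉ K) :
    ContinuousOn (fun t ↦ ∑ k ∈ K, ∑' j : zstarCompl K, interactionEnergy t j k) (Icc t₁ t₂) := by
  classical
  have hΛs : ∀ t ∈ Icc t₁ t₂, ∃ t₁' : ℝ, t₁' < t ∧ HasOnlyRealZeros (deBruijnH t₁') :=
    fun t ht ↦ ⟨t₀, lt_of_lt_of_le ht₀ ht.1, hreal⟩
  set F : ℕ → ℝ → ℝ := fun R t ↦
    ∑ k ∈ K, ∑ j ∈ zstarIcc (-(R : ℤ)) R \ K, interactionEnergy t j k with hF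
  -- the window sums are continuous
  have hFcont : ∀ R : ℕ, ContinuousOn (F R) (Icc t₁ t₂) := by
    intro R
    refine continuousOn_finsetSum K fun k hk ↦ continuousOn_finsetSum _ fun j hj t ht ↦ ?_
    have hΛt := hΛs t ht
    have hjk : j ≠ k := fun h ↦ (Finset.mem_sdiff.1 hj).2 (h ▸ hk)
    have h : ContinuousAt (fun s ↦ interactionEnergy s j k) t := by
      have e : (fun s ↦ interactionEnergy s j k) =
          fun s ↦ 1 / (deBruijnZeroZ s j - deBruijnZeroZ s k) ^ 2 := by
        funext s; rw [interactionEnergy_eq]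
      rw [e]
      exact continuousAt_const.div (((continuousAt_deBruijnZeroZ hΛt j).sub
        (continuousAt_deBruijnZeroZ hΛt k)).pow 2)
        (pow_ne_zero 2 (deBruijnZeroZ_sub_ne_zero hΛt hjk.symm))
    exact h.continuousWithinAt
  -- uniform convergence
  have hU : TendstoUniformlyOn F
      (fun t ↦ ∑ k ∈ K, ∑' j : zstarCompl K, interactionEnergy t j k) atTop (Icc t₁ t₂) := by
    refine Metric.tendstoUniformlyOn_iff.2 fun ε hε ↦ ?_
    obtain ⟨R₁, hR₁K, hR₁⟩ := exists_far_crossEnergy_le (t₂ := t₂) hreal ht₀ K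
      (show 0 < ε / (2 * (K.card + 1)) by positivity)
    refine eventually_atTop.2 ⟨R₁, fun R hR t ht ↦ ?_⟩
    have hKR : K ⊆ zstarIcc (-(R : ℤ)) R := subset_zstarIcc_of_le hK0 (hR₁K.trans hR)
    have hΛt := hΛs t ht
    rw [Real.dist_eq]
    have hsplit : ∑ k ∈ K, ∑' j : zstarCompl K, interactionEnergy t j k - F R t =
        ∑ k ∈ K, ∑' j : ↥((↑(Finset.Icc (-(R : ℤ)) R) : Set ℤ)ᶜ), interactionEnergy t j k := by
      simp only [hF]
      rw [← Finset.sum_sub_distrib]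
      refine Finset.sum_congr rfl fun k _ ↦ ?_
      rw [tsum_zstarCompl_eq_sum_add_tsum (summable_interactionEnergy_int_aux hΛt k) hKR]
      ring
    rw [hsplit]
    have hle : ∑ k ∈ K, ∑' j : ↥((↑(Finset.Icc (-(R : ℤ)) R) : Set ℤ)ᶜ), interactionEnergy t j k ≤
        ∑ k ∈ K, ε / (2 * (K.card + 1)) := Finset.sum_le_sum fun k hk ↦ hR₁ R hR t ht k hk
    have hnn : 0 ≤ ∑ k ∈ K, ∑' j : ↥((↑(Finset.Icc (-(R : ℤ)) R) : Set ℤ)ᶜ),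
        interactionEnergy t j k :=
      Finset.sum_nonneg fun k _ ↦ tsum_nonneg fun j ↦ interactionEnergy_nonneg t j k
    rw [abs_of_nonneg hnn]
    refine lt_of_le_of_lt hle ?_
    rw [Finset.sum_const, nsmul_eq_mul]
    have hc : (0 : ℝ) ≤ K.card := Nat.cast_nonneg _
    have : (K.card : ℝ) * (ε / (2 * (K.card + 1))) ≤ ε / 2 := by
      rw [mul_div_assoc', div_le_div_iff₀ (by positivity) (by positivity)]
      nlinarith
    linarith
  exact hU.continuousOn (Frequently.of_forall hFcont)


/-- AM–GM for the environment term: `|1/((x_j − x_k)(x_j − x_{k'}))| ≤ (E_{jk} + E_{jk'})/2`.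
[cite: RodgersTaoFMP2020, Lemma 14 (= v4 Lemma 5.2) proof pp. 34–35] -/
theorem abs_rodgersTaoCrossTerm_le (t : ℝ) (k k' j : ℤ) :
    |rodgersTaoCrossTerm t k k' j| ≤ (interactionEnergy t j k + interactionEnergy t j k') / 2 := by
  rw [rodgersTaoCrossTerm_eq, interactionEnergy_eq, interactionEnergy_eq]
  set u := deBruijnZeroZ t j - deBruijnZeroZ t k
  set v := deBruijnZeroZ t j - deBruijnZeroZ t k'
  rcases eq_or_ne u 0 with hu | hu
  · rw [hu]; simp only [zero_mul, div_zero, abs_zero]; positivity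
  rcases eq_or_ne v 0 with hv | hv
  · rw [hv]; simp only [mul_zero, div_zero, abs_zero]; positivity
  rw [abs_div, abs_one, abs_mul]
  have hu' : 0 < |u| := abs_pos.2 hu
  have hv' : 0 < |v| := abs_pos.2 hv
  rw [div_le_div_iff₀ (by positivity) (by positivity)]
  have h1 : (1 : ℝ) / u ^ 2 = 1 / |u| ^ 2 := by rw [sq_abs]
  have h2 : (1 : ℝ) / v ^ 2 = 1 / |v| ^ 2 := by rw [sq_abs]
  rw [h1, h2]
  have key : 1 * 2 * (|u| ^ 2 * |v| ^ 2) ≤ (|v| ^ 2 + |u| ^ 2) * (|u| * |v|) := by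
    nlinarith [sq_nonneg (|u| - |v|), mul_pos hu' hv']
  calc 1 * 2 = 1 * 2 * (|u| ^ 2 * |v| ^ 2) / (|u| ^ 2 * |v| ^ 2) := by
        field_simp
    _ ≤ (|v| ^ 2 + |u| ^ 2) * (|u| * |v|) / (|u| ^ 2 * |v| ^ 2) := by gcongr
    _ = (1 / |u| ^ 2 + 1 / |v| ^ 2) * (|u| * |v|) := by field_simp

/-- The environment sum is dominated by the cross energy: for `k ≠ k'` in `K`,
`|S_{kk'}(t)| ≤ B(t)/2` where `S_{kk'} = Σ_{j ∉ K} 1/((x_j − x_k)(x_j − x_{k'}))` and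
`B = Σ_{i ∈ K} Σ_{j ∉ K} E_{ji}`.
[cite: RodgersTaoFMP2020, Lemma 14 (= v4 Lemma 5.2) proof pp. 34–35] -/
theorem abs_rodgersTaoCrossSum_le_crossEnergy {t : ℝ}
    (hΛ : ∃ t₁ : ℝ, t₁ < t ∧ HasOnlyRealZeros (deBruijnH t₁)) {K : Finset ℤ} {k k' : ℤ}
    (hk : k ∈ K) (hk' : k' ∈ K) (hne : k ≠ k') :
    |rodgersTaoCrossSum t K k k'| ≤ (∑ i ∈ K, ∑' j : zstarCompl K, interactionEnergy t j i) / 2 := by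
  have hEk : Summable fun j : zstarCompl K ↦ interactionEnergy t j k :=
    (summable_interactionEnergy_int_aux hΛ k).subtype _
  have hEk' : Summable fun j : zstarCompl K ↦ interactionEnergy t j k' :=
    (summable_interactionEnergy_int_aux hΛ k').subtype _
  have hmaj : Summable fun j : zstarCompl K ↦
      (interactionEnergy t j k + interactionEnergy t j k') / 2 := (hEk.add hEk').div_const 2
  have hle : ∀ j : zstarCompl K, ‖rodgersTaoCrossTerm t k k' j‖ ≤
      (interactionEnergy t j k + interactionEnergy t j k') / 2 := fun j ↦ by
    rw [Real.norm_eq_abs]; exact abs_rodgersTaoCrossTerm_le t k k' j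
  have hnorm : Summable fun j : zstarCompl K ↦ ‖rodgersTaoCrossTerm t k k' j‖ :=
    Summable.of_nonneg_of_le (fun j ↦ norm_nonneg _) hle hmaj
  rw [rodgersTaoCrossSum]
  calc |∑' j : zstarCompl K, rodgersTaoCrossTerm t k k' j|
      = ‖∑' j : zstarCompl K, rodgersTaoCrossTerm t k k' j‖ := (Real.norm_eq_abs _).symm
    _ ≤ ∑' j : zstarCompl K, ‖rodgersTaoCrossTerm t k k' j‖ := norm_tsum_le_tsum_norm hnorm
    _ ≤ ∑' j : zstarCompl K, (interactionEnergy t j k + interactionEnergy t j k') / 2 :=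
        hnorm.tsum_le_tsum hle hmaj
    _ = (∑' j : zstarCompl K, interactionEnergy t j k +
          ∑' j : zstarCompl K, interactionEnergy t j k') / 2 := by
        rw [← hEk.tsum_add hEk', ← tsum_div_const]
    _ ≤ (∑ i ∈ K, ∑' j : zstarCompl K, interactionEnergy t j i) / 2 := by
        gcongr
        have hpair : ∑ i ∈ ({k, k'} : Finset ℤ), ∑' j : zstarCompl K, interactionEnergy t j i =
            ∑' j : zstarCompl K, interactionEnergy t j k +
              ∑' j : zstarCompl K, interactionEnergy t j k' := Finset.sum_pair hne
        rw [← hpair]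
        exact Finset.sum_le_sum_of_subset_of_nonneg
          (Finset.insert_subset_iff.2 ⟨hk, Finset.singleton_subset_iff.2 hk'⟩)
          fun i _ _ ↦ tsum_nonneg fun j ↦ interactionEnergy_nonneg t j i

/-- The quartic sum of Lemma 12 (ii) is at most `8 B²`:
`Σ_{k ∈ K} Σ_{j ∉ K} 8/(x_k − x_j)⁴ = 8 Σ E_{jk}² ≤ 8 (Σ E_{jk})²`.
[cite: RodgersTaoFMP2020, Lemma 14 (= v4 Lemma 5.2) proof pp. 34–35] -/
theorem quartic_sum_le_sq_crossEnergy {t : ℝ}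
    (hΛ : ∃ t₁ : ℝ, t₁ < t ∧ HasOnlyRealZeros (deBruijnH t₁)) (K : Finset ℤ) :
    ∑ k ∈ K, ∑' j : zstarCompl K, 8 / (deBruijnZeroZ t k - deBruijnZeroZ t j) ^ 4 ≤
      8 * (∑ k ∈ K, ∑' j : zstarCompl K, interactionEnergy t j k) ^ 2 := by
  set Bk : ℤ → ℝ := fun k ↦ ∑' j : zstarCompl K, interactionEnergy t j k with hBk
  have hBk0 : ∀ k, 0 ≤ Bk k := fun k ↦ tsum_nonneg fun j ↦ interactionEnergy_nonneg t j k
  have hsum : ∀ k, Summable fun j : zstarCompl K ↦ interactionEnergy t j k :=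
    fun k ↦ (summable_interactionEnergy_int_aux hΛ k).subtype _
  -- each inner quartic sum is at most `8 B_k²`
  have hinner : ∀ k ∈ K, ∑' j : zstarCompl K, 8 / (deBruijnZeroZ t k - deBruijnZeroZ t j) ^ 4 ≤
      8 * Bk k ^ 2 := by
    intro k _
    have hle : ∀ j : zstarCompl K, interactionEnergy t j k ≤ Bk k := fun j ↦
      (hsum k).le_tsum j fun i _ ↦ interactionEnergy_nonneg t i k
    have heq : ∀ j : zstarCompl K, 8 / (deBruijnZeroZ t k - deBruijnZeroZ t j) ^ 4 =
        8 * interactionEnergy t j k ^ 2 := by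
      intro j
      rw [interactionEnergy_eq]
      have : (deBruijnZeroZ t k - deBruijnZeroZ t j) ^ 4 =
          ((deBruijnZeroZ t j - deBruijnZeroZ t k) ^ 2) ^ 2 := by ring
      rw [this, one_div, inv_pow, div_eq_mul_inv]
    have hmaj : Summable fun j : zstarCompl K ↦ 8 * (Bk k * interactionEnergy t j k) :=
      ((hsum k).mul_left (Bk k)).mul_left 8
    have hq : Summable fun j : zstarCompl K ↦ 8 / (deBruijnZeroZ t k - deBruijnZeroZ t j) ^ 4 := by
      refine Summable.of_nonneg_of_le (fun j ↦ by positivity) (fun j ↦ ?_) hmaj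
      rw [heq, sq]
      exact mul_le_mul_of_nonneg_left (mul_le_mul_of_nonneg_right (hle j)
        (interactionEnergy_nonneg t j k)) (by norm_num)
    calc ∑' j : zstarCompl K, 8 / (deBruijnZeroZ t k - deBruijnZeroZ t j) ^ 4
        ≤ ∑' j : zstarCompl K, 8 * (Bk k * interactionEnergy t j k) := by
          refine hq.tsum_le_tsum (fun j ↦ ?_) hmaj
          rw [heq, sq]
          exact mul_le_mul_of_nonneg_left (mul_le_mul_of_nonneg_right (hle j)
            (interactionEnergy_nonneg t j k)) (by norm_num)
      _ = 8 * Bk k ^ 2 := by rw [tsum_mul_left, tsum_mul_left, sq]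
  -- sum over `k`: `Σ B_k² ≤ (Σ B_k)²`
  have hB : ∀ k ∈ K, Bk k ≤ ∑ i ∈ K, Bk i := fun k hk ↦
    Finset.single_le_sum (f := Bk) (fun i _ ↦ hBk0 i) hk
  calc ∑ k ∈ K, ∑' j : zstarCompl K, 8 / (deBruijnZeroZ t k - deBruijnZeroZ t j) ^ 4
      ≤ ∑ k ∈ K, 8 * Bk k ^ 2 := Finset.sum_le_sum hinner
    _ ≤ ∑ k ∈ K, 8 * (Bk k * ∑ i ∈ K, Bk i) := by
        refine Finset.sum_le_sum fun k hk ↦ ?_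
        rw [sq]
        exact mul_le_mul_of_nonneg_left (mul_le_mul_of_nonneg_left (hB k hk) (hBk0 k)) (by norm_num)
    _ = 8 * (∑ k ∈ K, Bk k) ^ 2 := by
        rw [← Finset.mul_sum, ← Finset.sum_mul, sq]

/-- **Integrated form of Lemma 12 (ii)**: for `Λ < s₁ < s₂`,
`B(s₁) ≤ B(s₂) + 8 ∫_{s₁}^{s₂} B(s)² ds` ("`∂_t B ≥ −8 B²` in the weak sense", source p. 34;
cf. Csordas–Smith–Varga 1994, Lemma 2.5).
[cite: RodgersTaoFMP2020, Lemma 14 (= v4 Lemma 5.2) proof pp. 34–35] -/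
theorem crossEnergy_le_add_integral_sq (hii : rodgers_tao_cross_energy_inequality) {t₀ s₁ s₂ : ℝ}
    (hreal : HasOnlyRealZeros (deBruijnH t₀)) (h₀ : t₀ < s₁) (h₁₂ : s₁ < s₂) (K : Finset ℤ)
    (hK0 : (0 : ℤ) ∉ K) :
    ∑ k ∈ K, ∑' j : zstarCompl K, interactionEnergy s₁ j k ≤
      ∑ k ∈ K, ∑' j : zstarCompl K, interactionEnergy s₂ j k +
        8 * ∫ s in s₁..s₂, (∑ k ∈ K, ∑' j : zstarCompl K, interactionEnergy s j k) ^ 2 := by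
  obtain ⟨hsumm, hint, hineq⟩ := hii K hK0 s₁ s₂ ⟨t₀, h₀, hreal⟩ h₁₂
  have hΛs : ∀ s ∈ Icc s₁ s₂, ∃ t₁ : ℝ, t₁ < s ∧ HasOnlyRealZeros (deBruijnH t₁) :=
    fun s hs ↦ ⟨t₀, lt_of_lt_of_le h₀ hs.1, hreal⟩
  -- the right-hand side of (ii) is `B(s₂) − B(s₁)`
  have hsub : ∑ k ∈ K, ∑' j : zstarCompl K, (interactionEnergy s₂ j k - interactionEnergy s₁ j k) =
      ∑ k ∈ K, ∑' j : zstarCompl K, interactionEnergy s₂ j k -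
        ∑ k ∈ K, ∑' j : zstarCompl K, interactionEnergy s₁ j k := by
    rw [← Finset.sum_sub_distrib]
    refine Finset.sum_congr rfl fun k hk ↦ ?_
    exact ((hsumm s₂ (right_mem_Icc.2 h₁₂.le) k hk).1).tsum_sub
      ((hsumm s₁ (left_mem_Icc.2 h₁₂.le) k hk).1)
  rw [hsub] at hineq
  -- the quartic integral is at most `8 ∫ B²`
  have hBcont := continuousOn_crossEnergy (t₂ := s₂) hreal h₀ K hK0
  have hB2int : IntervalIntegrable
      (fun s ↦ 8 * (∑ k ∈ K, ∑' j : zstarCompl K, interactionEnergy s j k) ^ 2)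
      volume s₁ s₂ := by
    refine (ContinuousOn.intervalIntegrable ?_)
    rw [Set.uIcc_of_le h₁₂.le]
    exact continuousOn_const.mul (hBcont.pow 2)
  have hmono := intervalIntegral.integral_mono_on h₁₂.le hint hB2int
    fun s hs ↦ quartic_sum_le_sq_crossEnergy (hΛs s hs) K
  rw [intervalIntegral.integral_const_mul] at hmono
  linarith

/-- **Backward no-doubling of the cross energy** (source p. 34: "`B(t')` cannot attain or exceed
the value `2B(t)` anywhere in the interval …"): with `b = B(t)` and
`L = min((t − t₀)/2, 1/(64(b+1)))`, one has `B(s) ≤ 2b + 1` for all `s ∈ [t − L, t]`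
(continuity of `B` + the integrated inequality).
[cite: RodgersTaoFMP2020, Lemma 14 (= v4 Lemma 5.2) proof pp. 34–35] -/
theorem crossEnergy_le_on_left (hii : rodgers_tao_cross_energy_inequality) {t₀ t : ℝ}
    (hreal : HasOnlyRealZeros (deBruijnH t₀)) (ht : t₀ < t) (K : Finset ℤ) (hK0 : (0 : ℤ) ∉ K)
    {s : ℝ}
    (hs₁ : t - min ((t - t₀) / 2) (1 / (64 * (∑ k ∈ K, ∑' j : zstarCompl K,
      interactionEnergy t j k + 1))) ≤ s) (hs₂ : s ≤ t) :
    ∑ k ∈ K, ∑' j : zstarCompl K, interactionEnergy s j k ≤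
      2 * (∑ k ∈ K, ∑' j : zstarCompl K, interactionEnergy t j k) + 1 := by
  set B : ℝ → ℝ := fun s ↦ ∑ k ∈ K, ∑' j : zstarCompl K, interactionEnergy s j k with hB
  set b : ℝ := B t with hb
  have hb0 : 0 ≤ b := Finset.sum_nonneg fun k _ ↦ tsum_nonneg fun j ↦ interactionEnergy_nonneg t j k
  set L : ℝ := min ((t - t₀) / 2) (1 / (64 * (b + 1))) with hL
  have hL0 : 0 < L := lt_min (by linarith) (by positivity)
  have hL1 : L ≤ (t - t₀) / 2 := min_le_left _ _
  have hL2 : L ≤ 1 / (64 * (b + 1)) := min_le_right _ _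
  have htL : t₀ < t - L := by linarith
  change t - L ≤ s at hs₁
  change B s ≤ 2 * b + 1
  -- continuity of `B` on `[t − L, t]`
  have hcont : ContinuousOn B (Icc (t - L) t) := continuousOn_crossEnergy hreal htL K hK0
  by_contra hnot
  push Not at hnot
  -- the closed set where `B ≥ 2b + 1`
  set S : Set ℝ := Icc (t - L) t ∩ B ⁻¹' (Ici (2 * b + 1)) with hS
  have hSclosed : IsClosed S := hcont.preimage_isClosed_of_isClosed isClosed_Icc isClosed_Ici
  have hsS : s ∈ S := ⟨⟨hs₁, hs₂⟩, hnot.le⟩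
  have hSne : S.Nonempty := ⟨s, hsS⟩
  have hSbdd : BddAbove S := ⟨t, fun u hu ↦ hu.1.2⟩
  set u : ℝ := sSup S with hu
  have huS : u ∈ S := hSclosed.csSup_mem hSne hSbdd
  have hu1 : t - L ≤ u := huS.1.1
  have hu2 : u ≤ t := huS.1.2
  have hBu : 2 * b + 1 ≤ B u := huS.2
  have hut : u < t := by
    rcases hu2.lt_or_eq with h | h
    · exact h
    · exfalso; rw [h] at hBu; change 2 * b + 1 ≤ b at hBu; linarith
  -- above `u`, `B < 2b + 1`
  have habove : ∀ v ∈ Icc u t, u < v → B v < 2 * b + 1 := by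
    intro v hv huv
    by_contra h
    push Not at h
    have hvS : v ∈ S := ⟨⟨hu1.trans hv.1, hv.2⟩, h⟩
    have := le_csSup hSbdd hvS
    linarith
  -- hence `B u = 2b + 1` (intermediate value theorem)
  have hcont' : ContinuousOn B (Icc u t) := hcont.mono (Icc_subset_Icc hu1 le_rfl)
  have hBu_eq : B u = 2 * b + 1 := by
    by_contra hne
    have hgt : 2 * b + 1 < B u := lt_of_le_of_ne hBu (Ne.symm hne)
    have hmem : 2 * b + 1 ∈ Icc (B t) (B u) := ⟨by change b ≤ 2 * b + 1; linarith, hgt.le⟩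
    obtain ⟨v, hv, hBv⟩ := intermediate_value_Icc' hut.le hcont' hmem
    rcases eq_or_lt_of_le hv.1 with h | h
    · rw [← h] at hBv; exact hne hBv
    · have := habove v hv h; rw [hBv] at this; exact lt_irrefl _ this
  -- the integrated inequality on `[u, t]`
  have hineq := crossEnergy_le_add_integral_sq hii hreal (lt_of_lt_of_le htL hu1) hut K hK0
  change B u ≤ B t + 8 * ∫ v in u..t, B v ^ 2 at hineq
  have hBle : ∀ v ∈ Icc u t, B v ^ 2 ≤ (2 * b + 1) ^ 2 := by
    intro v hv
    have hBv0 : 0 ≤ B v := Finset.sum_nonneg fun k _ ↦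
      tsum_nonneg fun j ↦ interactionEnergy_nonneg v j k
    have hBv : B v ≤ 2 * b + 1 := by
      rcases eq_or_lt_of_le hv.1 with h | h
      · rw [← h, hBu_eq]
      · exact (habove v hv h).le
    exact pow_le_pow_left₀ hBv0 hBv 2
  have hint1 : IntervalIntegrable (fun v ↦ B v ^ 2) volume u t := by
    refine ContinuousOn.intervalIntegrable ?_
    rw [Set.uIcc_of_le hut.le]
    exact hcont'.pow 2
  have hmono := intervalIntegral.integral_mono_on hut.le hint1 intervalIntegrable_const hBle
  rw [intervalIntegral.integral_const, smul_eq_mul] at hmono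
  -- `2b + 1 ≤ b + 8 (2b+1)² (t − u) ≤ b + 8 (2b+1)² L ≤ b + (b + 1)/2`: contradiction
  have htu : t - u ≤ L := by linarith
  have h1 : 8 * ∫ v in u..t, B v ^ 2 ≤ 8 * ((t - u) * (2 * b + 1) ^ 2) := by linarith
  have h2 : (t - u) * (2 * b + 1) ^ 2 ≤ L * (2 * b + 1) ^ 2 :=
    mul_le_mul_of_nonneg_right htu (by positivity)
  have h3 : L * (2 * b + 1) ^ 2 ≤ (1 / (64 * (b + 1))) * (2 * b + 1) ^ 2 :=
    mul_le_mul_of_nonneg_right hL2 (by positivity)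
  have h4 : (1 / (64 * (b + 1))) * (2 * b + 1) ^ 2 ≤ (b + 1) / 16 := by
    rw [div_mul_eq_mul_div, one_mul, div_le_div_iff₀ (by positivity) (by positivity)]
    nlinarith
  have : B u ≤ b + (b + 1) / 2 := by linarith
  rw [hBu_eq] at this
  linarith

/-- `1 − e^{−u} ≥ u/2` for `0 ≤ u ≤ 1`. [folklore] -/
private theorem half_le_one_sub_exp_neg {u : ℝ} (hu0 : 0 ≤ u) (hu1 : u ≤ 1) :
    u / 2 ≤ 1 - Real.exp (-u) := by
  have h1 : u + 1 ≤ Real.exp u := Real.add_one_le_exp u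
  have hpos : 0 < Real.exp u := Real.exp_pos u
  have h2 : Real.exp (-u) ≤ 1 / (u + 1) := by
    rw [Real.exp_neg, inv_eq_one_div, div_le_div_iff₀ hpos (by linarith)]
    linarith
  have h3 : u / 2 ≤ 1 - 1 / (u + 1) := by
    rw [show 1 - 1 / (u + 1) = u / (u + 1) by field_simp; ring]
    exact div_le_div_of_nonneg_left hu0 (by linarith) (by linarith)
  linarith

/-- **CONTENT form of Rodgers–Tao's Lemma 14 (= arXiv v4 Lemma 5.2)**, from the kernel identities
(ii) (cross-energy inequality) and (iv) (virial identity) of Lemma 12, taken as hypotheses here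
(they are theorems of `RodgersTaoZeroDynamicsProofs.lean`).
[cite: RodgersTaoFMP2020, Lemma 14 (= v4 Lemma 5.2) proof pp. 34–35] -/
theorem rodgers_tao_gap_cross_energy_of_lt_of (hii : rodgers_tao_cross_energy_inequality)
    (hiv : rodgers_tao_virial_identity) :
    ∀ t₀ t : ℝ, t₀ < t → HasOnlyRealZeros (deBruijnH t₀) → ∀ K : Finset ℤ, (0 : ℤ) ∉ K →
      2 ≤ K.card →
      min ((t - t₀) / 2) (1 / 64) * (K.card : ℝ) ^ 3 /
          (1 + ∑ k ∈ K, ∑' j : zstarCompl K, interactionEnergy t j k) ≤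
        ∑ p ∈ K.offDiag, (deBruijnZeroZ t p.1 - deBruijnZeroZ t p.2) ^ 2 := by
  intro t₀ t ht hreal K hK0 hK2
  set B : ℝ → ℝ := fun s ↦ ∑ k ∈ K, ∑' j : zstarCompl K, interactionEnergy s j k with hB
  set A : ℝ → ℝ := fun s ↦ ∑ p ∈ K.offDiag, (deBruijnZeroZ s p.1 - deBruijnZeroZ s p.2) ^ 2
    with hA
  set b : ℝ := B t with hb
  have hb0 : 0 ≤ b :=
    Finset.sum_nonneg fun k _ ↦ tsum_nonneg fun j ↦ interactionEnergy_nonneg t j k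
  have hA0 : ∀ s, 0 ≤ A s := fun s ↦ Finset.sum_nonneg fun p _ ↦ sq_nonneg _
  set L : ℝ := min ((t - t₀) / 2) (1 / (64 * (b + 1))) with hL
  have hL0 : 0 < L := lt_min (by linarith) (by positivity)
  have hL1 : L ≤ (t - t₀) / 2 := min_le_left _ _
  have hL2 : L ≤ 1 / (64 * (b + 1)) := min_le_right _ _
  have htL : t₀ < t - L := by linarith
  have hΛs : ∀ s : ℝ, t - L ≤ s → ∃ t₁ : ℝ, t₁ < s ∧ HasOnlyRealZeros (deBruijnH t₁) :=
    fun s hs ↦ ⟨t₀, by linarith, hreal⟩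
  -- `B ≤ 2b + 1` on `[t − L, t]`
  have hBle : ∀ s ∈ Icc (t - L) t, B s ≤ 2 * b + 1 :=
    fun s hs ↦ crossEnergy_le_on_left hii hreal ht K hK0 hs.1 hs.2
  -- constants
  set c : ℝ := (K.card : ℝ) with hc
  have hc2 : 2 ≤ c := by rw [hc]; exact_mod_cast hK2
  set N₀ : ℝ := 4 * c ^ 2 * (c - 1) with hN₀
  have hN₀0 : 0 ≤ N₀ := by rw [hN₀]; nlinarith
  set β : ℝ := 2 * (2 * b + 1) with hβ
  have hβ0 : 0 < β := by rw [hβ]; linarith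
  -- the derivative of `A` (Lemma 12 (iv)) and its lower bound
  set A' : ℝ → ℝ := fun s ↦ 4 * c ^ 2 * (c - 1) -
    ∑ p ∈ K.offDiag, (deBruijnZeroZ s p.1 - deBruijnZeroZ s p.2) ^ 2 *
      (4 * rodgersTaoCrossSum s K p.1 p.2) with hA'
  have hderiv : ∀ s ∈ Icc (t - L) t, HasDerivAt A (A' s) s ∧ N₀ - β * A s ≤ A' s := by
    intro s hs
    obtain ⟨-, hD⟩ := hiv s (hΛs s hs.1) K hK0
    refine ⟨hD, ?_⟩
    have hcoup : ∑ p ∈ K.offDiag, (deBruijnZeroZ s p.1 - deBruijnZeroZ s p.2) ^ 2 *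
        (4 * rodgersTaoCrossSum s K p.1 p.2) ≤ β * A s := by
      calc ∑ p ∈ K.offDiag, (deBruijnZeroZ s p.1 - deBruijnZeroZ s p.2) ^ 2 *
            (4 * rodgersTaoCrossSum s K p.1 p.2)
          ≤ ∑ p ∈ K.offDiag, (deBruijnZeroZ s p.1 - deBruijnZeroZ s p.2) ^ 2 *
            (4 * (B s / 2)) := by
            refine Finset.sum_le_sum fun p hp ↦ ?_
            have hp' := Finset.mem_offDiag.1 hp
            have habs := abs_rodgersTaoCrossSum_le_crossEnergy (hΛs s hs.1) hp'.1 hp'.2.1 hp'.2.2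
            exact mul_le_mul_of_nonneg_left
              (by linarith [le_abs_self (rodgersTaoCrossSum s K p.1 p.2)]) (sq_nonneg _)
        _ = 2 * B s * A s := by rw [hA]; dsimp only; rw [← Finset.sum_mul]; ring
        _ ≤ β * A s := by
            rw [hβ]
            exact mul_le_mul_of_nonneg_right (by linarith [hBle s hs]) (hA0 s)
    change N₀ - β * A s ≤ 4 * c ^ 2 * (c - 1) - _
    linarith
  -- Gronwall: `g(s) = (A(s) − N₀/β) e^{βs}` is non-decreasing on `[t − L, t]`
  set g : ℝ → ℝ := fun s ↦ (A s - N₀ / β) * Real.exp (β * s) with hg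
  set g' : ℝ → ℝ := fun s ↦ A' s * Real.exp (β * s) +
    (A s - N₀ / β) * (Real.exp (β * s) * (β * 1)) with hg'
  have hgd : ∀ s ∈ Icc (t - L) t, HasDerivAt g (g' s) s := by
    intro s hs
    have h1 := (hderiv s hs).1
    have h2 : HasDerivAt (fun s ↦ Real.exp (β * s)) (Real.exp (β * s) * (β * 1)) s :=
      (Real.hasDerivAt_exp (β * s)).comp s ((hasDerivAt_id s).const_mul β)
    exact (h1.sub_const (N₀ / β)).mul h2
  have hg'0 : ∀ s ∈ Icc (t - L) t, 0 ≤ g' s := by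
    intro s hs
    have h := (hderiv s hs).2
    have hexp : 0 < Real.exp (β * s) := Real.exp_pos _
    have : g' s = Real.exp (β * s) * (A' s + β * A s - N₀) := by
      simp only [hg']; field_simp; ring
    rw [this]
    exact mul_nonneg hexp.le (by linarith)
  have hmono : MonotoneOn g (Icc (t - L) t) := by
    refine monotoneOn_of_hasDerivWithinAt_nonneg (f' := g') (convex_Icc _ _)
      (fun s hs ↦ (hgd s hs).continuousAt.continuousWithinAt) (fun s hs ↦ ?_) (fun s hs ↦ ?_)
    · rw [interior_Icc] at hs
      exact (hgd s (Ioo_subset_Icc_self hs)).hasDerivWithinAt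
    · rw [interior_Icc] at hs
      exact hg'0 s (Ioo_subset_Icc_self hs)
  have hgle : g (t - L) ≤ g t :=
    hmono ⟨le_rfl, by linarith⟩ ⟨by linarith, le_rfl⟩ (by linarith)
  -- unpack: `A t ≥ (N₀/β)(1 − e^{−βL})`
  have hexp1 : 0 < Real.exp (β * (t - L)) := Real.exp_pos _
  have hexp2 : 0 < Real.exp (β * t) := Real.exp_pos _
  have hratio : Real.exp (β * (t - L)) = Real.exp (β * t) * Real.exp (-(β * L)) := by
    rw [← Real.exp_add]; congr 1; ring
  have hAt : N₀ / β * (1 - Real.exp (-(β * L))) ≤ A t := by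
    change (A (t - L) - N₀ / β) * Real.exp (β * (t - L)) ≤ (A t - N₀ / β) * Real.exp (β * t)
      at hgle
    have h1 : -(N₀ / β) * Real.exp (β * (t - L)) ≤ (A t - N₀ / β) * Real.exp (β * t) := by
      refine le_trans ?_ hgle
      exact mul_le_mul_of_nonneg_right (by linarith [hA0 (t - L)]) hexp1.le
    rw [hratio] at h1
    have h2 : (N₀ / β * (1 - Real.exp (-(β * L)))) * Real.exp (β * t) ≤ A t * Real.exp (β * t) := by
      nlinarith
    exact le_of_mul_le_mul_right h2 hexp2
  -- `βL ≤ 1/16 ≤ 1`, so `1 − e^{−βL} ≥ βL/2`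
  have hβL : β * L ≤ 1 := by
    have h1 : β * L ≤ β * (1 / (64 * (b + 1))) := mul_le_mul_of_nonneg_left hL2 hβ0.le
    have h2 : β * (1 / (64 * (b + 1))) ≤ 1 := by
      rw [hβ, mul_one_div, div_le_one (by positivity)]; nlinarith
    linarith
  have hmain : N₀ * L / 2 ≤ A t := by
    have h1 := half_le_one_sub_exp_neg (by positivity : 0 ≤ β * L) hβL
    have h2 : N₀ / β * (β * L / 2) ≤ N₀ / β * (1 - Real.exp (-(β * L))) :=
      mul_le_mul_of_nonneg_left h1 (by positivity)
    have h3 : N₀ / β * (β * L / 2) = N₀ * L / 2 := by field_simp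
    linarith
  -- `L ≥ min((t−t₀)/2, 1/64)/(b+1)` and `c²(c−1) ≥ c³/2`
  have hLge : min ((t - t₀) / 2) (1 / 64) / (b + 1) ≤ L := by
    have hb1 : 1 ≤ b + 1 := by linarith
    refine le_min ?_ ?_
    · calc min ((t - t₀) / 2) (1 / 64) / (b + 1) ≤ min ((t - t₀) / 2) (1 / 64) / 1 :=
            div_le_div_of_nonneg_left (le_min (by linarith) (by norm_num)) one_pos hb1
        _ ≤ (t - t₀) / 2 := by rw [div_one]; exact min_le_left _ _
    · rw [show 1 / (64 * (b + 1)) = (1 / 64) / (b + 1) by field_simp]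
      exact div_le_div_of_nonneg_right (min_le_right _ _) (by linarith)
  have hcube : c ^ 3 / 2 ≤ c ^ 2 * (c - 1) := by nlinarith
  have hm0 : 0 ≤ min ((t - t₀) / 2) (1 / 64) := le_min (by linarith) (by norm_num)
  change min ((t - t₀) / 2) (1 / 64) * c ^ 3 / (1 + b) ≤ A t
  calc min ((t - t₀) / 2) (1 / 64) * c ^ 3 / (1 + b)
      = (min ((t - t₀) / 2) (1 / 64) / (b + 1)) * (2 * (c ^ 3 / 2)) := by
        rw [add_comm 1 b]; ring
    _ ≤ L * (2 * (c ^ 2 * (c - 1))) := by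
        gcongr
    _ = N₀ * L / 2 := by rw [hN₀]; ring
    _ ≤ A t := hmain

/-- **Rodgers–Tao 2020, Lemma 14 (= arXiv v4 Lemma 5.2) — RH-free CONTENT, house (time-translated)
form.** For `t₀ < t` with `H_{t₀}` real-rooted and every finite `K ⊂ ℤ*` with `|K| ≥ 2`:
`min((t − t₀)/2, 1/64) · |K|³ / (1 + Σ_{k ∈ K} Σ_{j ∈ ℤ* ∖ K} E_{jk}(t)) ≤ Σ_{(k,k') ∈ K², k ≠ k'} (x_k(t) − x_{k'}(t))²`.
The printed statement ("`≫ |K|³/(1 + Σ E_{jk})` for `Λ/2 ≤ t ≤ 0`", constants depending on `Λ`)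
is the instance `t₀ = Λ < 0`, `t ∈ [Λ/2, 0]` (there `t − t₀ ≥ |Λ|/2`), typed as the named fact
`rodgers_tao_gap_cross_energy` (VACUOUS-AS-PRINTED since `Λ ≥ 0`); this theorem is its RH-free
content, from the kernel Lemma 12 (ii) and (iv). [cite: RodgersTaoFMP2020, Lemma 14 (= v4 Lemma 5.2) pp. 34–35] -/
theorem rodgers_tao_gap_cross_energy_of_lt :
    ∀ t₀ t : ℝ, t₀ < t → HasOnlyRealZeros (deBruijnH t₀) → ∀ K : Finset ℤ, (0 : ℤ) ∉ K →
      2 ≤ K.card →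
      min ((t - t₀) / 2) (1 / 64) * (K.card : ℝ) ^ 3 /
          (1 + ∑ k ∈ K, ∑' j : zstarCompl K, interactionEnergy t j k) ≤
        ∑ p ∈ K.offDiag, (deBruijnZeroZ t p.1 - deBruijnZeroZ t p.2) ^ 2 :=
  rodgers_tao_gap_cross_energy_of_lt_of rodgers_tao_cross_energy_inequality_holds
    rodgers_tao_virial_identity_holds

end Literature.NumberTheory.LFunctions

end
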